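import Summits.CriticalPhenomena.PercolationContinuityZ3.Theorems.PercNearOneGluingNoHeavyPcintMeanMemZ3M10Check1
import Summits.CriticalPhenomena.PercolationContinuityZ3.Theorems.PercNearOneGluingNoHeavyPcintMeanMemZ3M10Check2
import Summits.CriticalPhenomena.PercolationContinuityZ3.Theorems.PercNearOneGluingNoHeavyPcintMeanMemZ3M10Check3
import Summits.CriticalPhenomena.PercolationContinuityZ3.Theorems.PercNearOneGluingNoHeavyPcintMeanMemZ3M10Check4
import HarnessLib

/-!
# PCINT lane, kernel reduced-state B3m certificate `Z3M10` (bond, d = 3, memory τ = 10, kc = 4, 3084 state classes): the theorem `p_c^bond(ℤ^3) ≥ 0.2229`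

Cell `prim-pcint`, seat `prim-pcint-2` (gen 4); memo `run/shared/lean/prim/pcint/REDUCTIONS.md` §B3m and HANDOFF ("B3m on reduced states").
Does NOT build on p205010.  Data for `BondK.le_criticalProb_of_checkRowsM` (`…PcintMeanMemKernelCert`): `p = 22290/100000`, chain
parameter `kc = 4`, `s̄ = 97485/100000` (`s̄²+p² ≥ 1`), `t̄ = 91875/100000` (`(1-p)(1+2p) ≤ t̄(1+p)`, `1-p ≤ s̄ t̄²`, `t̄ ≤ s̄²`), `t̄' = 95938/100000`
(`p² ≤ (t̄'-t̄)(1+p)`), mean corner-third unit `m̄ = 93907/100000 ≥ (t̄+t̄')/2`, `κ̄ = (100000²+97485²)/(2·100000²)`, `λ = 99999/100000`; Collatz–Wielandt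
weights (scale 10⁹) from a power iteration (ρ ≈ 0.9998420), exact off-line max row ratio 0.9998420419 < λ.  Generated by
work/gen/gen_b3m_kernel.py (prim-pcint-2 gen 4 folder; copy in run/shared/lean/prim/pcint/prim-pcint-2/kernel/); the kernel re-checks every row.
-/

namespace Summit.CriticalPhenomena.PercolationContinuityZ3.Theorems.Pcint

open Literature.Probability.Percolation Literature.Probability.LatticeModels

/-- Every row of the certificate passes. [folklore] -/
theorem MeanMemZ3M10.all_rows : WinK.allRange (BondK.checkRowM 10 4 3 3084 22290 97485 91875 93907 100000 99999 100000 MeanMemZ3M10.syms MeanMemZ3M10.tree) 0 3084 = true := (WinK.allRange_split (WinK.allRange_split (WinK.allRange_split MeanMemZ3M10.file_1 MeanMemZ3M10.file_2) MeanMemZ3M10.file_3) MeanMemZ3M10.file_4)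

/-- **`p_c^bond(ℤ^3) ≥ 0.2229`** (kernel-checked reduced-state B3m certificate: chord refunds + chain bonus + third-incidence and coin-averaged
corner-third units on the memory-`10` dangerous-set automaton, chain parameter `kc = 4`, 3084 state classes, `decide +kernel` only). [folklore] -/
theorem criticalProb_Z3_ge_02229 : (0.2229 : ℝ) ≤ criticalProb (zdGraph 3) 0 := by
  have h := BondK.le_criticalProb_of_checkRowsM (d := 3) (τ := 10) (kc := 4) (N := 3084) (pn := 22290) (S := 97485) (T := 91875)
    (T3 := 95938) (M := 93907) (D := 100000) (lamN := 99999) (lamD := 100000) (syms := MeanMemZ3M10.syms) (t := MeanMemZ3M10.tree) (by norm_num) (by norm_num)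
    (fun c => NawK.symOfTab 3 (MeanMemZ3M10.syms.getD c [])) (NawK.syms_spec_of_valid MeanMemZ3M10.syms_valid)
    (fun i hi => WinK.of_allRange MeanMemZ3M10.all_rows (Nat.zero_le i) hi)
    (by norm_num) (by decide +kernel) (by norm_num) (by norm_num) (by norm_num) (by norm_num) (by norm_num) (by norm_num)
    (by norm_num) (by norm_num) (by norm_num) (by norm_num) (by norm_num) (by norm_num) (by norm_num) (by norm_num)
  have e : ((22290 : ℕ) : ℝ) / ((100000 : ℕ) : ℝ) = (0.2229 : ℝ) := by norm_num
  rw [e] at h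
  exact h

end Summit.CriticalPhenomena.PercolationContinuityZ3.Theorems.Pcint
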